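import Summits.BirchSwinnertonDyer.BirchSwinnertonDyer.Theorems.ByReductionTypeAtTwoRankOneAtTwoOneDoorFirstDescentDefs
import Summits.BirchSwinnertonDyer.BirchSwinnertonDyer.Theorems.ByReductionTypeAtTwoRankOneAtTwoBigImageOddLocalOneDoorKummerRestriction
import Summits.BirchSwinnertonDyer.BirchSwinnertonDyer.Theorems.ByReductionTypeAtTwoRankOneAtTwoBigImageOddLocalOneDoorHalvesBookkeeping
import Summits.BirchSwinnertonDyer.BirchSwinnertonDyer.Theorems.ByReductionTypeAtTwoRankOneAtTwoBigImageOddLocalOneDoorGlue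
import Summits.BirchSwinnertonDyer.BirchSwinnertonDyer.Theorems.ByReductionTypeAtTwoRankOneAtTwoBigImageOddLocalOneDoorAnalyticPrimary
import Literature.NumberTheory.EllipticCurves.WeakMordellWeilReduction
import Literature.NumberTheory.EllipticCurves.PointDivisibilityProofs
import HarnessLib

/-!
# Route ByReductionTypeAtTwo, crux `RankOneAtTwoBigImageOddLocal` (stmt-BirchSwinnertonDyer-23715), LINE v8.9 `one_door_analytic`:
# the HEEGNER CLASS `y` of the bottom rung — fields `y`, `y_mem`, `y_ne` of `FirstDescentInput`, with `res_K y = κ_K(y_K)`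

Lead prover seat `bsd-line-fkl-p1` g12 (2026-08-28), `--supports stmt-BirchSwinnertonDyer-23715` (helper).  THEOREMS ONLY; no
definition, no named fact introduced, no `sorry`; BSD is not proved by any of this.

At a datum of the bottom rung (slice curve `W`, door field `K`, Heegner point `P ∈ E(K)` with `m = 0`, i.e. `P ∉ 2E(K) + E(K)_tors`) the
E-side of Kolyvagin's first `2`-descent over `ℚ` needs ONE non-zero class `y ∈ Sel₂(W/ℚ)` whose restriction to `K` is the Kummer class of the
Heegner point (so that Gross's Prop. 6.2 (2) — route GenusKolyvaginAtTwo item 24880, stated over `K` — reads `y` at the Kolyvagin primes).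
Lead report G11 §2 takes `y = δ(T·y_K)` through the conjugation law `τ y_K ≡ y_K (mod torsion)`; this file AVOIDS the conjugation law on
Heegner points: with `g` a Mordell–Weil generator of `E(ℚ)` (rank one by Gross–Zagier–Kolyvagin, PRINT) put **`y := κ_ℚ(g)`**; then
`y ∈ Sel₂(W/ℚ)` (Kummer classes are Selmer), `y ≠ 0` (`g ∉ 2E(ℚ)`), and **`res_K y = κ_K(P)`**: `rank E(K) = 1` (Kolyvagin over `K`) with
generator `G`, `P ≡ a·G`, `g ≡ b·G` modulo the ODD torsion of `E(K)`; `a` is odd because `m = 0`; `b` is odd because `T·G` (`T = #E(K)_tors`)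
is `Gal(K/ℚ)`-fixed — `τG − G` is torsion, as `b·(τG − G) ≡ τg − g = 0` — hence rational (Galois descent), so `b ∣ T`; therefore
`P − g ∈ 2E(K)` and `κ_K(P) = κ_K(g) = res_K κ_ℚ(g)` (naturality `resTorsion_kummerMapTorsion`, `Theorems/…OneDoorKummerRestriction.lean`).

* §1 rank-one bookkeeping modulo odd torsion (fact-free group theory);
* §2 `odd_coeff_of_map_ofId` — the coefficient of a rational non-torsion point along a generator of `E(K)` is odd when `#E(K)_tors` is odd;
* §3 `exists_heegnerClass_at` — **at a bottom-rung datum: `∃ y ∈ Sel₂(W/ℚ)`, `y ≠ 0`, `resTorsion W K 2 y = kummerMapTorsion (W⁄K) 2 _ P`**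
  (modulo Gross–Zagier, Kolyvagin, modularity, Hoffstein–Luo for the two ranks — the primary PRINT facts of `S_pub4`).

References: [GrossLMS1991] §2 (2.2)–(2.3), §10; [SilvermanAEC2009] VIII.§2, X.§4; [Kolyvagin1990] Thm. A (rank `E(K) = 1`).
-/

set_option autoImplicit false
-- the Theorems namespace of this sub repeats the summit name by design (D-0017 nested layout)
set_option linter.dupNamespace false

noncomputable section

open scoped Classical

namespace Summit.BirchSwinnertonDyer.BirchSwinnertonDyer.Theorems.RankOneAtTwoOneDoor

open WeierstrassCurve NumberField Literature.NumberTheory.EllipticCurves Literature.NumberTheory.EllipticCurves.ModularForms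
  Literature.NumberTheory.GaloisRepresentations Literature.NumberTheory.EllipticCurves.KrizLi2019
  Summit.BirchSwinnertonDyer.Rank1Residual.F1Sign2
  Summit.BirchSwinnertonDyer.Rank1Residual.F1Sign2.TranspositionDoor

/-! ### §1 Rank-one bookkeeping modulo odd torsion -/

section Algebra

variable {A : Type*} [AddCommGroup A]

/-- An element of ODD finite order is twice an element (`t = 2 • ((r+1)/2 • t)`, `r` the order). [folklore] -/
theorem exists_two_nsmul_eq_of_addOrderOf_odd {t : A} (hodd : Odd (addOrderOf t)) : ∃ t' : A, 2 • t' = t := by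
  obtain ⟨k, hk⟩ := hodd
  refine ⟨(k + 1) • t, ?_⟩
  rw [← mul_nsmul, show (k + 1) * 2 = addOrderOf t + 1 by omega, add_nsmul, addOrderOf_nsmul_eq_zero, zero_add, one_nsmul]

/-- In a group whose torsion subgroup is finite of ODD order every torsion element is twice an element. [folklore] -/
theorem exists_two_nsmul_eq_of_mem_torsion [Finite (AddCommGroup.torsion A)] (hodd : Odd (Nat.card (AddCommGroup.torsion A)))
    {t : A} (ht : t ∈ AddCommGroup.torsion A) : ∃ t' : A, 2 • t' = t := by
  have hdvd : addOrderOf (⟨t, ht⟩ : AddCommGroup.torsion A) ∣ Nat.card (AddCommGroup.torsion A) := addOrderOf_dvd_natCard _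
  have hodd' : Odd (addOrderOf t) := by
    rw [← AddSubgroup.addOrderOf_coe (⟨t, ht⟩ : AddCommGroup.torsion A)] at hdvd
    exact hodd.of_dvd_nat hdvd
  exact exists_two_nsmul_eq_of_addOrderOf_odd hodd'

/-- `b • s` torsion with `b ≠ 0` forces `s` torsion. [folklore] -/
theorem mem_torsion_of_zsmul_mem_torsion {b : ℤ} (hb : b ≠ 0) {s : A} (h : b • s ∈ AddCommGroup.torsion A) :
    s ∈ AddCommGroup.torsion A := by
  rw [AddCommGroup.mem_torsion, isOfFinAddOrder_iff_zsmul_eq_zero] at h ⊢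
  obtain ⟨n, hn, hns⟩ := h
  exact ⟨n * b, mul_ne_zero hn hb, by rw [mul_zsmul, hns]⟩

/-- **The coefficient of a point that is NOT twice a point up to torsion is odd**: `P − a • G` torsion and `¬ ∃ Q, P − 2 • Q` torsion force
`a` odd (else `Q = (a/2) • G`). [cite: GrossLMS1991, §2 (2.2)] -/
theorem odd_coeff_of_notTwice {P G : A} {a : ℤ} (hP : P - a • G ∈ AddCommGroup.torsion A)
    (hnt : ¬ ∃ Q : A, P - 2 • Q ∈ AddCommGroup.torsion A) : Odd a := by
  by_contra ha
  rw [Int.not_odd_iff_even] at ha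
  obtain ⟨c, rfl⟩ := ha
  exact hnt ⟨c • G, by rwa [two_nsmul, ← add_zsmul]⟩

/-- **Two points with odd coefficients along the same generator differ by a double**, when the torsion is finite of odd order:
`P − a•G`, `g − b•G` torsion with `a`, `b` odd ⟹ `P − g = 2 • R`. [cite: GrossLMS1991, §2 (2.2)] -/
theorem exists_sub_eq_two_zsmul [Finite (AddCommGroup.torsion A)] (hodd : Odd (Nat.card (AddCommGroup.torsion A)))
    {P g G : A} {a b : ℤ} (hP : P - a • G ∈ AddCommGroup.torsion A) (hg : g - b • G ∈ AddCommGroup.torsion A)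
    (ha : Odd a) (hb : Odd b) : ∃ R : A, (2 : ℤ) • R = P - g := by
  have ht : (P - a • G) - (g - b • G) ∈ AddCommGroup.torsion A := (AddCommGroup.torsion A).sub_mem hP hg
  obtain ⟨t', ht'⟩ := exists_two_nsmul_eq_of_mem_torsion hodd ht
  obtain ⟨c, hc⟩ : Even (a - b) := Odd.sub_odd ha hb
  refine ⟨c • G + t', ?_⟩
  rw [zsmul_add, smul_smul, two_mul, ← hc, show (2 : ℤ) • t' = 2 • t' from (natCast_zsmul t' 2).symm ▸ rfl, ht']
  rw [sub_smul]
  abel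

/-- The image of a torsion element under a homomorphism is torsion. [folklore] -/
theorem map_mem_torsion {B : Type*} [AddCommGroup B] (f : A →+ B) {t : A} (ht : t ∈ AddCommGroup.torsion A) :
    f t ∈ AddCommGroup.torsion B := by
  rw [AddCommGroup.mem_torsion, isOfFinAddOrder_iff_nsmul_eq_zero] at ht ⊢
  obtain ⟨n, hn, hnt⟩ := ht
  exact ⟨n, hn, by rw [← map_nsmul, hnt, map_zero]⟩

/-- A non-torsion element stays non-torsion under an injective homomorphism. [folklore] -/
theorem not_mem_torsion_map_of_injective {B : Type*} [AddCommGroup B] (f : A →+ B) (hf : Function.Injective f) {g : A}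
    (hg : g ∉ AddCommGroup.torsion A) : f g ∉ AddCommGroup.torsion B := by
  rw [AddCommGroup.mem_torsion, isOfFinAddOrder_iff_nsmul_eq_zero] at hg ⊢
  rintro ⟨n, hn, hng⟩
  exact hg ⟨n, hn, hf (by rw [map_nsmul, hng, map_zero])⟩

end Algebra

/-! ### §1b The kernel of the Kummer map, pointwise (generic base field: instances as in `KummerMap`) -/

section KummerKer

universe u

variable {F : Type u} [Field F] [PerfectField F] (V : WeierstrassCurve F) (n : ℤ)
  (hdiv : ∀ P : geomPoints V, ∃ Q : geomPoints V, n • Q = P)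

/-- `κ P = 0 ⟹ P ∈ nE(F)` (pointwise form of `kummerMapTorsion_ker`). [cite: SilvermanAEC2009, VIII.§2] -/
theorem exists_zsmul_eq_of_kummerMapTorsion_eq_zero {P : V.toAffine.Point} (h : kummerMapTorsion V n hdiv P = 0) :
    ∃ R : V.toAffine.Point, n • R = P := by
  have hmem : P ∈ (kummerMapTorsion V n hdiv).ker := h
  rw [kummerMapTorsion_ker] at hmem
  obtain ⟨R, hR⟩ := hmem
  exact ⟨R, hR⟩

/-- `P = n • R ⟹ κ P = 0` (pointwise form of `kummerMapTorsion_ker`). [cite: SilvermanAEC2009, VIII.§2] -/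
theorem kummerMapTorsion_eq_zero_of_zsmul_eq {P R : V.toAffine.Point} (h : n • R = P) : kummerMapTorsion V n hdiv P = 0 := by
  have hmem : P ∈ (kummerMapTorsion V n hdiv).ker := by
    rw [kummerMapTorsion_ker]
    exact ⟨R, h⟩
  exact hmem

end KummerKer

/-! ### §2 A rational non-torsion point has an ODD coefficient along a generator of `E(K)` modulo odd torsion -/

section Galois

variable {F : Type} [Field F] [NumberField F] (W : WeierstrassCurve F) (K : Type) [Field K] [NumberField K] [Algebra F K]

omit [NumberField F] [NumberField K] in
/-- **`τG − G` is torsion** for every `τ ∈ Aut(K/F)` when a non-zero multiple `b • G` is an `F`-RATIONAL point up to torsion: `ι g − b • G`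
torsion with `τ(ι g) = ι g` gives `b • (τG − G)` torsion.  (Generic base field `F`: the group structure on `E(F)` is then elaborated with the
same decidability instance as the tree's rank-one bookkeeping.) [folklore] -/
theorem map_sub_self_mem_torsion (τ : K ≃ₐ[F] K) {G : (W.baseChange K).toAffine.Point} {g : W.toAffine.Point} {b : ℤ} (hb0 : b ≠ 0)
    (hb : Affine.Point.map (W' := W) (Algebra.ofId F K) g - b • G ∈ AddCommGroup.torsion (W.baseChange K).toAffine.Point) :
    Affine.Point.map (W' := W) (τ : K →ₐ[F] K) G - G ∈ AddCommGroup.torsion (W.baseChange K).toAffine.Point := by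
  let f : (W.baseChange K).toAffine.Point →+ (W.baseChange K).toAffine.Point := Affine.Point.map (W' := W) (τ : K →ₐ[F] K)
  have key : f (Affine.Point.map (W' := W) (Algebra.ofId F K) g - b • G) =
      Affine.Point.map (W' := W) (Algebra.ofId F K) g - b • f G := by
    rw [map_sub, map_zsmul]
    congr 1
    exact Affine.Point.map_algEquiv_map_ofId τ g
  have h1 : Affine.Point.map (W' := W) (Algebra.ofId F K) g - b • f G ∈ AddCommGroup.torsion (W.baseChange K).toAffine.Point := by
    have := map_mem_torsion f hb
    rwa [key] at this
  have h2 := (AddCommGroup.torsion _).sub_mem hb h1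
  have h3 : (Affine.Point.map (W' := W) (Algebra.ofId F K) g - b • G) -
      (Affine.Point.map (W' := W) (Algebra.ofId F K) g - b • f G) = b • (f G - G) := by
    rw [zsmul_sub]; abel
  rw [h3] at h2
  exact mem_torsion_of_zsmul_mem_torsion hb0 h2

/-- **The coefficient of an `F`-rational non-torsion point along a generator of `E(K)` is ODD** when `#E(K)_tors` is odd (`K/F` quadratic).
`G` a generator of `E(K)` modulo torsion (`huniq`), `g ∈ E(F)` non-torsion generating `E(F)` modulo torsion (`hgenQ`), `ι g ≡ b • G`:
`T • G` (`T = #E(K)_tors`) is fixed by `Gal(K/F)` (`map_sub_self_mem_torsion`), hence `F`-rational (Galois descent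
`exists_map_ofId_eq_of_forall_map_algEquiv_eq`), `≡ c • g ≡ cb • G`, so `T = cb` and `b ∣ T` is odd.
[cite: SilvermanAEC2009, Lemma VIII.1.1.1 (proof)] [cite: GrossLMS1991, §2 (2.2)] -/
theorem odd_coeff_of_map_ofId [W.IsElliptic] (h2 : Module.finrank F K = 2) (hodd : Odd (W.baseChange K).torsionOrder)
    {G : (W.baseChange K).toAffine.Point}
    (huniq : ∀ n : ℤ, n • G ∈ AddCommGroup.torsion (W.baseChange K).toAffine.Point → n = 0)
    {g : W.toAffine.Point} (hg : ¬ IsOfFinAddOrder g)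
    (hgenQ : ∀ x : W.toAffine.Point, ∃ n : ℤ, x - n • g ∈ AddCommGroup.torsion W.toAffine.Point)
    {b : ℤ} (hb : Affine.Point.map (W' := W) (Algebra.ofId F K) g - b • G ∈ AddCommGroup.torsion (W.baseChange K).toAffine.Point) :
    Odd b := by
  haveI hEK : (W.baseChange K).IsElliptic := isElliptic_baseChange' W K
  haveI := (W.baseChange K).finite_torsion_point
  haveI : Algebra.IsQuadraticExtension F K := ⟨h2⟩
  let ι : W.toAffine.Point →+ (W.baseChange K).toAffine.Point := Affine.Point.map (W' := W) (Algebra.ofId F K)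
  have hιinj : Function.Injective ι := Affine.Point.map_injective (W' := W) (Algebra.ofId F K)
  have hb' : ι g - b • G ∈ AddCommGroup.torsion (W.baseChange K).toAffine.Point := hb
  -- `b ≠ 0`: `g` is not torsion and `ι` is injective
  have hb0 : b ≠ 0 := by
    rintro rfl
    rw [zero_smul, sub_zero] at hb'
    exact not_mem_torsion_map_of_injective ι hιinj (by rwa [AddCommGroup.mem_torsion]) hb'
  -- `T • G` is `Gal(K/F)`-fixed
  set T := (W.baseChange K).torsionOrder with hT
  have hfix : ∀ τ : K ≃ₐ[F] K, Affine.Point.map (W' := W) (τ : K →ₐ[F] K) (T • G) = T • G := by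
    intro τ
    have hs := map_sub_self_mem_torsion W K τ hb0 hb
    have hTs : T • (Affine.Point.map (W' := W) (τ : K →ₐ[F] K) G - G) = 0 := by
      have h := card_nsmul_eq_zero' (x := (⟨_, hs⟩ : AddCommGroup.torsion (W.baseChange K).toAffine.Point))
      have h' := congrArg Subtype.val h
      rw [AddSubgroupClass.coe_nsmul, ZeroMemClass.coe_zero] at h'
      rw [hT]
      unfold WeierstrassCurve.torsionOrder
      exact h'
    rw [nsmul_sub, sub_eq_zero, ← map_nsmul] at hTs
    exact hTs
  -- hence `F`-rational
  obtain ⟨P₀, hP₀⟩ := Affine.Point.exists_map_ofId_eq_of_forall_map_algEquiv_eq (W := W) (T • G) hfix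
  have hP₀' : ι P₀ = T • G := hP₀
  -- `P₀ ≡ c • g`, so `T • G ≡ (c * b) • G` and `T = c * b`
  obtain ⟨c, hc⟩ := hgenQ P₀
  have h1 : ι P₀ - c • ι g ∈ AddCommGroup.torsion (W.baseChange K).toAffine.Point := by
    have := map_mem_torsion ι hc
    rwa [map_sub, map_zsmul] at this
  have h2' : c • (ι g - b • G) ∈ AddCommGroup.torsion (W.baseChange K).toAffine.Point :=
    (AddCommGroup.torsion _).zsmul_mem hb' c
  have h3 : ((T : ℤ) - c * b) • G ∈ AddCommGroup.torsion (W.baseChange K).toAffine.Point := by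
    have hsum := (AddCommGroup.torsion _).add_mem h1 h2'
    have : ι P₀ - c • ι g + c • (ι g - b • G) = ((T : ℤ) - c * b) • G := by
      rw [hP₀', sub_zsmul, natCast_zsmul, mul_zsmul, zsmul_sub]
      abel
    rw [this] at hsum
    exact hsum
  have hTcb : (T : ℤ) = c * b := sub_eq_zero.mp (huniq _ h3)
  -- `b ∣ T` is odd
  have hdvd : b.natAbs ∣ T := by
    rw [← Int.natAbs_natCast T, hTcb, Int.natAbs_mul]
    exact dvd_mul_left _ _
  rw [← Int.natAbs_odd]
  exact hodd.of_dvd_nat hdvd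

end Galois

/-! ### §3 The Heegner class at a bottom-rung datum -/

section Bottom

/-- **A Mordell–Weil generator is not twice a point**: `g = 2 • R` with every point `≡ n • g` modulo torsion and `n • g` torsion only for
`n = 0` is absurd (`(1 − 2n) • g` torsion).  (The group structure is an IMPLICIT binder, inferred from the hypotheses: over `ℚ` the tree's
rank-one bookkeeping carries the classical decidability instance on `E(ℚ)`, not `instDecidableEqRat`.) [folklore] -/
theorem not_exists_two_zsmul_eq_generator {A : Type*} {_ : AddCommGroup A} {g : A}
    (hgen : ∀ x : A, ∃ n : ℤ, x - n • g ∈ AddCommGroup.torsion A) (huniq : ∀ n : ℤ, n • g ∈ AddCommGroup.torsion A → n = 0) :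
    ¬ ∃ R : A, (2 : ℤ) • R = g := by
  rintro ⟨R, hR⟩
  obtain ⟨n, hn⟩ := hgen R
  have h : (1 - 2 * n) • g ∈ AddCommGroup.torsion A := by
    have h2 := (AddCommGroup.torsion A).zsmul_mem hn 2
    rw [zsmul_sub, hR, smul_smul] at h2
    have e : (1 - 2 * n) • g = g - (2 * n) • g := by module
    rw [e]; exact h2
  have := huniq _ h
  omega

/-- **THE HEEGNER CLASS `y` AT A BOTTOM-RUNG DATUM.**  `W/ℚ` globally minimal with odd torsion order and analytic rank `1`; `K` imaginary
quadratic, `d_K` door-admissible, `L(W^{(d_K)},1) ≠ 0`; a parametrisation datum with `P ∈ E(K)` over its complex Heegner point and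
`P ∉ 2E(K) + E(K)_tors` (`m = 0`); Gross–Zagier and Kolyvagin (universally, as in `S_pub4`), modularity as a newform and Hoffstein–Luo (for
`rank W(ℚ) = 1` and `rank E(K) = 1`); `2`-divisibility of `E(ℚ̄)`, `E(K̄)` supplied (`zsmul_geomPoints_surjective_holds`).  THEN there is
`y ∈ Sel₂(W/ℚ)`, `y ≠ 0`, with **`res_K y = κ_K(P)`** at level `2` — the fields `y`, `y_mem`, `y_ne` of `FirstDescentInput` together with the
bridge to Gross's Prop. 6.2 (2) over `K`.  `y = κ_ℚ(g)` for a Mordell–Weil generator `g` of `E(ℚ)`; `P − g_K ∈ 2E(K)` by §§1–2.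
[cite: GrossLMS1991, §2 (2.2)–(2.3) and §10] [cite: SilvermanAEC2009, VIII.§2, X.§4] [cite: Kolyvagin1990, Thm. A] -/
theorem exists_heegnerClass_at
    (hGZ : ∀ (N : ℕ) [NeZero N] (W : WeierstrassCurve ℚ) (K : Type) [Field K] [NumberField K], gross_zagier N W K)
    (hKo : ∀ (N : ℕ) [NeZero N] (W : WeierstrassCurve ℚ) (K : Type) [Field K] [NumberField K], kolyvagin N W K)
    (hnf : exists_isNewformOf) (hHL : HoffsteinLuo1997_exists_twist_L_one_ne_zero)
    (W : WeierstrassCurve ℚ) [W.IsElliptic] [W.IsGloballyMinimal] [NeZero (W.conductorNorm ℤ)]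
    (hT : Odd W.torsionOrder) (hr : W.analyticRank = 1)
    (K : Type) [Field K] [NumberField K] (hK : IsImaginaryQuadratic K)
    (hadm : DoorAdmissible W (NumberField.discr K))
    (hLt : (W.quadraticTwist (NumberField.discr K : ℚ)).entireLFunction 1 ≠ 0)
    (Dt : ModularParametrizationData W (W.conductorNorm ℤ))
    (H : HeegnerDatum (W.conductorNorm ℤ) (NumberField.discr K)) (ι : K →+* ℂ)
    (P : (W.baseChange K).toAffine.Point)
    (hP : WeierstrassCurve.Affine.Point.map ι.toRatAlgHom P = heegnerPointComplex Dt H)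
    (hm : HasTwoDivisibilityUpToTorsion W K P 0)
    (hdivQ : ∀ Q : geomPoints W, ∃ R : geomPoints W, (2 : ℤ) • R = Q)
    (hdivK : ∀ Q : geomPoints (W.baseChange K), ∃ R : geomPoints (W.baseChange K), (2 : ℤ) • R = Q) :
    ∃ y : galH1Torsion W 2, y ∈ selmerGroup W 2 ∧ y ≠ 0 ∧
      resTorsion W K 2 y = kummerMapTorsion (W.baseChange K) 2 hdivK P := by
  haveI hEK : (W.baseChange K).IsElliptic := isElliptic_baseChange' W K
  haveI := (W.baseChange K).finite_torsion_point
  have h2K : Module.finrank ℚ K = 2 := hK.1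
  have hmod : hasEntireLFunction_rat := hasEntireLFunction_rat_of_exists_isNewformOf hnf
  -- rank `W(ℚ) = 1`: a Mordell–Weil generator `g`
  have hrQ : W.mordellWeilRank = 1 := (mordellWeilRank_eq_one_of_analyticRank_eq_one_of_isGloballyMinimal hGZ hKo hnf hHL W hr).1
  obtain ⟨g, hg, hgenQ, huniqQ, -⟩ := KrizLi2019.exists_generator_regulator_eq_of_mordellWeilRank_eq_one W hrQ
  -- rank `E(K) = 1`: a generator `G`
  obtain ⟨hrkK, -, -, -⟩ := exists_unique_exponent_at_door hmod W hr K hK (hGZ _ W K) (hKo _ W K) hadm hLt Dt H ι P hP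
  obtain ⟨G, -, hgenK, huniqK, -⟩ := KrizLi2019.exists_generator_regulator_eq_of_mordellWeilRank_eq_one (W.baseChange K) hrkK
  -- odd torsion over `K`
  have hoddK : Odd (W.baseChange K).torsionOrder :=
    odd_torsionOrder_baseChange_of_noRationalTwoTorsion W (noRationalTwoTorsion_of_odd_torsionOrder W hT) K h2K
  have hoddK' : Odd (Nat.card (AddCommGroup.torsion (W.baseChange K).toAffine.Point)) := hoddK
  -- coefficients: `P ≡ a • G` with `a` odd (`m = 0`), `g_K ≡ b • G` with `b` odd (§2)
  obtain ⟨a, ha⟩ := hgenK P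
  obtain ⟨b, hb⟩ := hgenK (Affine.Point.map (W' := W) (Algebra.ofId ℚ K) g)
  have hPnt : ¬ ∃ Q : (W.baseChange K).toAffine.Point, P - 2 • Q ∈ AddCommGroup.torsion (W.baseChange K).toAffine.Point := by
    obtain ⟨Q, hPQ, hQ⟩ := hm
    have hPQ' : P - Q ∈ AddCommGroup.torsion (W.baseChange K).toAffine.Point := by
      rw [pow_zero, one_nsmul] at hPQ
      exact hPQ
    rintro ⟨R, hR⟩
    have h := (AddCommGroup.torsion (W.baseChange K).toAffine.Point).sub_mem hR hPQ'
    have e : P - 2 • R - (P - Q) = Q - 2 • R := by abel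
    rw [e] at h
    exact hQ ⟨R, h⟩
  have haodd : Odd a := odd_coeff_of_notTwice ha hPnt
  have hbodd : Odd b := odd_coeff_of_map_ofId W K h2K hoddK huniqK hg hgenQ hb
  -- `P − g_K ∈ 2E(K)`
  obtain ⟨R, hR⟩ := exists_sub_eq_two_zsmul hoddK' ha hb haodd hbodd
  -- the class `y = κ_ℚ(g)`
  refine ⟨kummerMapTorsion W 2 hdivQ g, ?_, ?_, ?_⟩
  · rw [mem_selmerGroup_iff]
    exact ⟨fun v => kummerMapTorsion_mem_selmerLocalKer W 2 hdivQ _ g, fun w => kummerMapTorsion_mem_selmerLocalKer W 2 hdivQ _ g⟩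
  · intro h0
    exact not_exists_two_zsmul_eq_generator hgenQ huniqQ (exists_zsmul_eq_of_kummerMapTorsion_eq_zero W 2 hdivQ h0)
  · rw [resTorsion_kummerMapTorsion W K 2 hdivQ hdivK g]
    -- `κ_K(g_K) = κ_K(P)` since `P − g_K = 2 • R`
    have hker : kummerMapTorsion (W.baseChange K) 2 hdivK (P - Affine.Point.map (W' := W) (Algebra.ofId ℚ K) g) = 0 :=
      kummerMapTorsion_eq_zero_of_zsmul_eq (W.baseChange K) 2 hdivK hR
    rw [map_sub, sub_eq_zero] at hker
    exact hker.symm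

end Bottom

end Summit.BirchSwinnertonDyer.BirchSwinnertonDyer.Theorems.RankOneAtTwoOneDoor

end
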